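import Literature.AlgebraicGeometry.Motives.MixedHodgeExtensionTensorHomAdjunction
import Literature.AlgebraicGeometry.Motives.MixedHodgeExtensionUnitInternalHomNaturality
import HarnessLib

/-!
# Naturality of the tensor–Hom adjunction `Ext(A ⊗ C, B) ≅ Ext(A, Hom(C, B))` in `A`, `B`, `C`

Deligne–Milne, *Tannakian categories* (LNM 900), §1 (1.6.1): the internal Hom is characterised by the
adjunction `Hom(T ⊗ X, Y) ≅ Hom(T, Hom(X, Y))` FUNCTORIAL in `T` (and natural in `X`, `Y`); Carlson,
*Extensions of mixed Hodge structures* (1980), §2(b) Prop. 1: `Ext(∗, ∗)` is a bifunctor. The tree's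
`Ext.tensorHomAdj A C B` (`MixedHodgeExtensionTensorHomAdjunction`) is the composite
`unitInternalHomEquivW ∘ (curry)_* ∘ unitInternalHomEquivW⁻¹`; with the naturality of Jannsen's
`unitInternalHomEquivW` in both variables (`MixedHodgeExtensionUnitInternalHomNaturality`) and the
naturality of the curry isomorphism of internal Homs (§1), this file proves:

* §1 naturality of `homTensorCurry` in each variable (as equalities of morphisms of MHS) and of
  `Hom(C, B) ≅ C^∨ ⊗ B` in `B`, `C`;
* §2 **`adj (g_* x) = Hom(C, g)_* (adj x)`**, **`adj ((f ⊗ 1)^* x) = f^* (adj x)`**,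
  **`adj ((1 ⊗ h)^* x) = Hom(h, B)_* (adj x)`** (`Ext.tensorHomAdj_pushoutMapW`, `_pullbackMapW_tensorMap_id`,
  `_pullbackMapW_id_tensorMap`), and the corresponding statements for the rigid form
  `Ext(A ⊗ C, B) ≅ Ext(A, C^∨ ⊗ B)`.

All statements proved; no named facts.

## References

* [DeligneMilne1982Tannakian] P. Deligne, J. S. Milne, Tannakian categories, LNM 900 (1982), §1
  (1.6.1)–(1.6.4).
* [Carlson1980] J. A. Carlson, Extensions of mixed Hodge structures (1980), §2(b) Prop. 1.
* [DeligneHodgeII1971] P. Deligne, Théorie de Hodge II, 1.1.12.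
* [Jannsen1990MixedMotives] U. Jannsen, Mixed Motives and Algebraic K-Theory, LNM 1400 (1990), §9
  Remark 9.3 a).
-/

open scoped TensorProduct

noncomputable section

namespace Literature.AlgebraicGeometry.Motives

namespace MixedHodgeStructure

open HodgeStructure (tate)

universe u v x u' v' x'

variable {VA : Type u} [AddCommGroup VA] [Module ℚ VA] [FiniteDimensional ℚ VA]
variable {VB : Type v} [AddCommGroup VB] [Module ℚ VB] [FiniteDimensional ℚ VB]
variable {VC : Type x} [AddCommGroup VC] [Module ℚ VC] [FiniteDimensional ℚ VC]
variable {VA' : Type u'} [AddCommGroup VA'] [Module ℚ VA'] [FiniteDimensional ℚ VA']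
variable {VB' : Type v'} [AddCommGroup VB'] [Module ℚ VB'] [FiniteDimensional ℚ VB']
variable {VC' : Type x'} [AddCommGroup VC'] [Module ℚ VC'] [FiniteDimensional ℚ VC']

/-! ### §1 Naturality of the curry isomorphism and of `Hom(C, B) ≅ C^∨ ⊗ B` -/

section Curry

variable {A : MixedHodgeStructure VA} {B : MixedHodgeStructure VB} {C : MixedHodgeStructure VC}
variable {A' : MixedHodgeStructure VA'} {B' : MixedHodgeStructure VB'} {C' : MixedHodgeStructure VC'}

variable (A C) in
/-- **Curry is natural in the target**: `curry ∘ Hom(A ⊗ C, g) = Hom(A, Hom(C, g)) ∘ curry`.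
[cite: DeligneMilne1982Tannakian, §1 (1.6.1)] -/
theorem homTensorCurry_comp_homMap_right (g : Hom B B') :
    (homTensorCurry A C B').comp (Hom.homMap (Hom.id (tensor A C)) g) =
      (Hom.homMap (Hom.id A) (Hom.homMap (Hom.id C) g)).comp (homTensorCurry A C B) :=
  Hom.ext (LinearMap.ext fun φ => LinearMap.ext fun a => LinearMap.ext fun c => by
    simp only [Hom.comp_toLinearMap, LinearMap.comp_apply, homTensorCurry_toLinearMap_apply,
      Hom.homMap_toLinearMap_apply, Hom.id_toLinearMap, LinearMap.id_apply])

variable (C B) in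
/-- **Curry is natural in the first tensor factor**: `curry ∘ Hom(f ⊗ 1, B) = Hom(f, Hom(C, B)) ∘ curry`.
[cite: DeligneMilne1982Tannakian, §1 (1.6.1)] -/
theorem homTensorCurry_comp_homMap_tensorMap_id (f : Hom A' A) :
    (homTensorCurry A' C B).comp (Hom.homMap (f.tensorMap (Hom.id C)) (Hom.id B)) =
      (Hom.homMap f (Hom.id (hom C B))).comp (homTensorCurry A C B) :=
  Hom.ext (LinearMap.ext fun φ => LinearMap.ext fun a => LinearMap.ext fun c => by
    simp only [Hom.comp_toLinearMap, LinearMap.comp_apply, homTensorCurry_toLinearMap_apply,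
      Hom.homMap_toLinearMap_apply, Hom.id_toLinearMap, LinearMap.id_apply, LinearMap.id_comp,
      Hom.tensorMap_apply_tmul])

variable (A B) in
/-- **Curry is natural in the second tensor factor**: `curry ∘ Hom(1 ⊗ h, B) = Hom(A, Hom(h, B)) ∘ curry`.
[cite: DeligneMilne1982Tannakian, §1 (1.6.1)] -/
theorem homTensorCurry_comp_homMap_id_tensorMap (h : Hom C' C) :
    (homTensorCurry A C' B).comp (Hom.homMap ((Hom.id A).tensorMap h) (Hom.id B)) =
      (Hom.homMap (Hom.id A) (Hom.homMap h (Hom.id B))).comp (homTensorCurry A C B) :=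
  Hom.ext (LinearMap.ext fun φ => LinearMap.ext fun a => LinearMap.ext fun c => by
    simp only [Hom.comp_toLinearMap, LinearMap.comp_apply, homTensorCurry_toLinearMap_apply,
      Hom.homMap_toLinearMap_apply, Hom.id_toLinearMap, LinearMap.id_apply, LinearMap.id_comp,
      Hom.tensorMap_apply_tmul])

variable (C B) in
/-- **`Hom(C, B) ≅ C^∨ ⊗ B` is natural**: `(Hom ≅ ⊗) ∘ Hom(f, g) = (ᵗf ⊗ g) ∘ (Hom ≅ ⊗)` — immediate
from the tree's definition `Hom(f, g) = (⊗ ≅ Hom) ∘ (ᵗf ⊗ g) ∘ (Hom ≅ ⊗)`. [cite: DeligneMilne1982Tannakian, §1 (1.6.4)] -/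
theorem homToTensor_comp_homMap (f : Hom C' C) (g : Hom B B') :
    (homToTensor C' B').comp (Hom.homMap f g) = (f.transpose.tensorMap g).comp (homToTensor C B) :=
  Hom.ext (by
    rw [Hom.homMap, Hom.comp_toLinearMap, Hom.comp_toLinearMap, Hom.comp_toLinearMap,
      ← LinearMap.comp_assoc, ← Hom.comp_toLinearMap, homToTensor_comp_tensorToHom, Hom.id_toLinearMap,
      LinearMap.id_comp])

variable (C B) in
/-- `(Hom(C, ·) ≅ C^∨ ⊗ ·)` is natural in the target: `(Hom ≅ ⊗) ∘ Hom(C, g) = (1 ⊗ g) ∘ (Hom ≅ ⊗)`.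
[cite: DeligneMilne1982Tannakian, §1 (1.6.4)] -/
theorem homToTensor_comp_homMap_id (g : Hom B B') :
    (homToTensor C B').comp (Hom.homMap (Hom.id C) g) = ((Hom.id C.dual).tensorMap g).comp (homToTensor C B) := by
  rw [homToTensor_comp_homMap, Hom.transpose_id]

end Curry

/-! ### §2 Naturality of `Ext(A ⊗ C, B) ≅ Ext(A, Hom(C, B))` -/

namespace Ext

variable (A : MixedHodgeStructure VA) (C : MixedHodgeStructure VC) (B : MixedHodgeStructure VB)
variable {A' : MixedHodgeStructure VA'} {B' : MixedHodgeStructure VB'} {C' : MixedHodgeStructure VC'}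

/-- **The adjunction is natural in `B`**: for `g : B → B'`, `adj (g_* x) = Hom(C, g)_* (adj x)`.
[cite: DeligneMilne1982Tannakian, §1 (1.6.1)] [cite: Carlson1980, §2(b) Prop. 1] -/
theorem tensorHomAdj_pushoutMapW (g : Hom B B') (x : Ext (tensor A C) B) :
    tensorHomAdj A C B' (pushoutMapW g x) = pushoutMapW (Hom.homMap (Hom.id C) g) (tensorHomAdj A C B x) := by
  rw [tensorHomAdj_apply, tensorHomAdj_apply, unitInternalHomEquivW_symm_pushoutMapW, ← pushoutMapW_comp,
    homTensorCurry_comp_homMap_right, pushoutMapW_comp, unitInternalHomEquivW_pushoutMapW_homMap_id]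

/-- **The adjunction is natural in `A`**: for `f : A' → A`, `adj ((f ⊗ 1)^* x) = f^* (adj x)`
(Deligne–Milne (1.6.1): functoriality in `T`). [cite: DeligneMilne1982Tannakian, §1 (1.6.1)]
[cite: Carlson1980, §2(b) Prop. 1] -/
theorem tensorHomAdj_pullbackMapW_tensorMap_id (f : Hom A' A) (x : Ext (tensor A C) B) :
    tensorHomAdj A' C B (pullbackMapW (f.tensorMap (Hom.id C)) x) = pullbackMapW f (tensorHomAdj A C B x) := by
  rw [tensorHomAdj_apply, tensorHomAdj_apply, unitInternalHomEquivW_symm_pullbackMapW, ← pushoutMapW_comp,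
    homTensorCurry_comp_homMap_tensorMap_id, pushoutMapW_comp, unitInternalHomEquivW_pushoutMapW_homMap_id']

/-- **The adjunction is natural in `C`**: for `h : C' → C`, `adj ((1 ⊗ h)^* x) = Hom(h, B)_* (adj x)`.
[cite: DeligneMilne1982Tannakian, §1 (1.6.1)] [cite: Carlson1980, §2(b) Prop. 1] -/
theorem tensorHomAdj_pullbackMapW_id_tensorMap (h : Hom C' C) (x : Ext (tensor A C) B) :
    tensorHomAdj A C' B (pullbackMapW ((Hom.id A).tensorMap h) x) =
      pushoutMapW (Hom.homMap h (Hom.id B)) (tensorHomAdj A C B x) := by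
  rw [tensorHomAdj_apply, tensorHomAdj_apply, unitInternalHomEquivW_symm_pullbackMapW, ← pushoutMapW_comp,
    homTensorCurry_comp_homMap_id_tensorMap, pushoutMapW_comp, unitInternalHomEquivW_pushoutMapW_homMap_id]

/-- **Joint naturality**: `adj ((f ⊗ h)^* g_* x) = f^* Hom(h, g)_* (adj x)` for `f : A' → A`,
`h : C' → C`, `g : B → B'`. [cite: DeligneMilne1982Tannakian, §1 (1.6.1)] [cite: Carlson1980, §2(b) Prop. 1] -/
theorem tensorHomAdj_pullbackMapW_tensorMap_pushoutMapW (f : Hom A' A) (h : Hom C' C) (g : Hom B B')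
    (x : Ext (tensor A C) B) :
    tensorHomAdj A' C' B' (pullbackMapW (f.tensorMap h) (pushoutMapW g x)) =
      pullbackMapW f (pushoutMapW (Hom.homMap h g) (tensorHomAdj A C B x)) := by
  have hfh : f.tensorMap h = ((Hom.id A).tensorMap h).comp (f.tensorMap (Hom.id C')) :=
    Hom.ext (by
      rw [Hom.comp_toLinearMap, Hom.tensorMap_toLinearMap, Hom.tensorMap_toLinearMap, Hom.tensorMap_toLinearMap,
        ← TensorProduct.map_comp, Hom.id_toLinearMap, Hom.id_toLinearMap, LinearMap.id_comp, LinearMap.comp_id])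
  have hhg : Hom.homMap h g = (Hom.homMap h (Hom.id B')).comp (Hom.homMap (Hom.id C) g) :=
    Hom.ext (LinearMap.ext fun φ => by
      simp only [Hom.comp_toLinearMap, LinearMap.comp_apply, Hom.homMap_toLinearMap_apply, Hom.id_toLinearMap,
        LinearMap.id_comp, LinearMap.comp_id, LinearMap.comp_assoc])
  rw [hfh, pullbackMapW_comp, tensorHomAdj_pullbackMapW_tensorMap_id, tensorHomAdj_pullbackMapW_id_tensorMap,
    tensorHomAdj_pushoutMapW, ← pushoutMapW_comp, ← hhg]

/-- The inverse adjunction is natural in `B`: `adj⁻¹ (Hom(C, g)_* y) = g_* (adj⁻¹ y)`.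
[cite: DeligneMilne1982Tannakian, §1 (1.6.1)] -/
theorem tensorHomAdj_symm_pushoutMapW (g : Hom B B') (y : Ext A (hom C B)) :
    (tensorHomAdj A C B').symm (pushoutMapW (Hom.homMap (Hom.id C) g) y) =
      pushoutMapW g ((tensorHomAdj A C B).symm y) := by
  apply (tensorHomAdj A C B').injective
  rw [Equiv.apply_symm_apply, tensorHomAdj_pushoutMapW, Equiv.apply_symm_apply]

/-- The inverse adjunction is natural in `A`: `adj⁻¹ (f^* y) = (f ⊗ 1)^* (adj⁻¹ y)`.
[cite: DeligneMilne1982Tannakian, §1 (1.6.1)] -/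
theorem tensorHomAdj_symm_pullbackMapW (f : Hom A' A) (y : Ext A (hom C B)) :
    (tensorHomAdj A' C B).symm (pullbackMapW f y) =
      pullbackMapW (f.tensorMap (Hom.id C)) ((tensorHomAdj A C B).symm y) := by
  apply (tensorHomAdj A' C B).injective
  rw [Equiv.apply_symm_apply, tensorHomAdj_pullbackMapW_tensorMap_id, Equiv.apply_symm_apply]

/-- The inverse adjunction is natural in `C`: `adj⁻¹ (Hom(h, B)_* y) = (1 ⊗ h)^* (adj⁻¹ y)`.
[cite: DeligneMilne1982Tannakian, §1 (1.6.1)] -/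
theorem tensorHomAdj_symm_pushoutMapW_homMap (h : Hom C' C) (y : Ext A (hom C B)) :
    (tensorHomAdj A C' B).symm (pushoutMapW (Hom.homMap h (Hom.id B)) y) =
      pullbackMapW ((Hom.id A).tensorMap h) ((tensorHomAdj A C B).symm y) := by
  apply (tensorHomAdj A C' B).injective
  rw [Equiv.apply_symm_apply, tensorHomAdj_pullbackMapW_id_tensorMap, Equiv.apply_symm_apply]

/-! ### The rigid form `Ext(A ⊗ C, B) ≅ Ext(A, C^∨ ⊗ B)` -/

/-- **`Ext(A ⊗ C, B) ≅ Ext(A, C^∨ ⊗ B)` is natural in `B`**: `(g_* x) ↦ (1 ⊗ g)_* (·)`.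
[cite: DeligneMilne1982Tannakian, §1 (1.6.4)] [cite: Carlson1980, §2(b) Prop. 1] -/
theorem tensorDualAdj_pushoutMapW (g : Hom B B') (x : Ext (tensor A C) B) :
    tensorDualAdj A C B' (pushoutMapW g x) =
      pushoutMapW ((Hom.id C.dual).tensorMap g) (tensorDualAdj A C B x) := by
  rw [tensorDualAdj_apply, tensorDualAdj_apply, tensorHomAdj_pushoutMapW, ← pushoutMapW_comp,
    homToTensor_comp_homMap_id, pushoutMapW_comp]

/-- **`Ext(A ⊗ C, B) ≅ Ext(A, C^∨ ⊗ B)` is natural in `A`**: `((f ⊗ 1)^* x) ↦ f^* (·)`.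
[cite: DeligneMilne1982Tannakian, §1 (1.6.4)] [cite: Carlson1980, §2(b) Prop. 1] -/
theorem tensorDualAdj_pullbackMapW_tensorMap_id (f : Hom A' A) (x : Ext (tensor A C) B) :
    tensorDualAdj A' C B (pullbackMapW (f.tensorMap (Hom.id C)) x) = pullbackMapW f (tensorDualAdj A C B x) := by
  rw [tensorDualAdj_apply, tensorDualAdj_apply, tensorHomAdj_pullbackMapW_tensorMap_id, pushoutMapW_pullbackMapW]

/-- **`Ext(A ⊗ C, B) ≅ Ext(A, C^∨ ⊗ B)` is natural in `C`**: `((1 ⊗ h)^* x) ↦ (ᵗh ⊗ 1)_* (·)`.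
[cite: DeligneMilne1982Tannakian, §1 (1.6.4)] [cite: Carlson1980, §2(b) Prop. 1] -/
theorem tensorDualAdj_pullbackMapW_id_tensorMap (h : Hom C' C) (x : Ext (tensor A C) B) :
    tensorDualAdj A C' B (pullbackMapW ((Hom.id A).tensorMap h) x) =
      pushoutMapW (h.transpose.tensorMap (Hom.id B)) (tensorDualAdj A C B x) := by
  rw [tensorDualAdj_apply, tensorDualAdj_apply, tensorHomAdj_pullbackMapW_id_tensorMap, ← pushoutMapW_comp,
    homToTensor_comp_homMap, pushoutMapW_comp]

end Ext

end MixedHodgeStructure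

end Literature.AlgebraicGeometry.Motives

end
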